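import Mathlib.Probability.Distributions.Gaussian.Multivariate
import Mathlib.Analysis.InnerProductSpace.GramSchmidtOrtho
import Mathlib.Analysis.SpecialFunctions.Exponential
import Literature.Probability.Distributions.GaussianPiDensity
import HarnessLib

/-!
# Gaussian measure of resonance slabs and polynomial absorption

`Literature/Probability/Distributions/` — two measure estimates for the product Gaussian
`⊗ᵐ 𝒩(0, v)` on `ℝ^m` used in KAM-type resonance counting (e.g. W. De Roeck, F. Huveneers,
CPAM 68 (2015), §4.3 Lemma 3 and §5.5 Lemma 4 (2): "the desired bound `∼ η^p` on the measure of an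
`η`-neighborhood of a subspace of codimension `p`"), all PROVED:

* `gaussianReal_Icc_le`: `𝒩(0,v)([-c, c]) ≤ 2c/√(2πv)`;
* `pi_gaussianReal_coordBox`: the measure of a coordinate box `{|ω_i| ≤ c, i ∈ I}` is `𝒩(0,v)([-c,c])^{|I|}`;
* `pi_gaussianReal_one_orthBox`: for an orthonormal basis `b` of `ℝ^m`, `{|⟪b_i, ω⟫| ≤ c, i ∈ I}` has the
  same `⊗ᵐ𝒩(0,1)`-measure (rotation invariance, via Mathlib's `stdGaussian_map`);
* **`pi_gaussianReal_one_slabs_le`** / **`pi_gaussianReal_slabs_le`**: for linearly independent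
  `v_1, …, v_p ∈ ℝ^m` there is `C` with `⊗ᵐ𝒩(0,v){ω : |v_j · ω| ≤ η ∀ j} ≤ C η^p` for all `η ≥ 0`
  (Gram–Schmidt inside `span(v_j)`, then the orthonormal box; variance `v` by scaling);
* **`lintegral_indicator_weight_le`** (absorption): `∫ 𝟙_S (1 + ‖ω‖)^M d⊗ᵐ𝒩(0,v) ≤ K · ⊗ᵐ𝒩(0,2v)(S)`,
  from the pointwise bound `(1 + ‖ω‖)^M e^{-|ω|²/2v} ≤ K' e^{-|ω|²/4v}`.
-/

noncomputable section

open MeasureTheory ProbabilityTheory Set Filter Finset WithLp InnerProductSpace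
open scoped ENNReal NNReal BigOperators Topology InnerProductSpace

namespace Literature.Probability.Distributions

/-! ### One-dimensional interval bound -/

/-- The Gaussian density is bounded by its value at the mean. [folklore] -/
theorem gaussianPDFReal_le_peak (μ : ℝ) (v : ℝ≥0) (x : ℝ) :
    gaussianPDFReal μ v x ≤ (Real.sqrt (2 * Real.pi * v))⁻¹ := by
  rw [gaussianPDFReal]
  have h1 : Real.exp (-(x - μ) ^ 2 / (2 * v)) ≤ 1 := by
    rw [Real.exp_le_one_iff]
    apply div_nonpos_of_nonpos_of_nonneg
    · nlinarith [sq_nonneg (x - μ)]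
    · positivity
  have h0 : 0 ≤ (Real.sqrt (2 * Real.pi * v))⁻¹ := by positivity
  nlinarith

/-- **`𝒩(0,v)([-c, c]) ≤ 2c / √(2πv)`.** [folklore] -/
theorem gaussianReal_Icc_le {v : ℝ≥0} (hv : v ≠ 0) (c : ℝ) :
    gaussianReal 0 v (Set.Icc (-c) c) ≤ ENNReal.ofReal (2 * c * (Real.sqrt (2 * Real.pi * v))⁻¹) := by
  rw [gaussianReal_apply _ hv]
  calc ∫⁻ x in Set.Icc (-c) c, gaussianPDF 0 v x
      ≤ ∫⁻ _ in Set.Icc (-c) c, ENNReal.ofReal ((Real.sqrt (2 * Real.pi * v))⁻¹) :=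
        lintegral_mono fun x => ENNReal.ofReal_le_ofReal (gaussianPDFReal_le_peak 0 v x)
    _ = ENNReal.ofReal ((Real.sqrt (2 * Real.pi * v))⁻¹) * volume (Set.Icc (-c) c) := setLIntegral_const _ _
    _ = ENNReal.ofReal (2 * c * (Real.sqrt (2 * Real.pi * v))⁻¹) := by
        rw [Real.volume_Icc, show c - -c = 2 * c by ring, ← ENNReal.ofReal_mul (by positivity)]
        ring_nf

/-! ### Coordinate boxes -/

/-- The coordinate box `{ω : |ω_i| ≤ c for i ∈ I}`. [folklore] -/
def coordBox (m : ℕ) (I : Finset (Fin m)) (c : ℝ) : Set (Fin m → ℝ) := {w | ∀ i ∈ I, |w i| ≤ c}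

/-- The coordinate box as a product set. [folklore] -/
theorem coordBox_eq_pi (m : ℕ) (I : Finset (Fin m)) (c : ℝ) :
    coordBox m I c = Set.pi Set.univ fun i => if i ∈ I then Set.Icc (-c) c else Set.univ := by
  ext w
  simp only [coordBox, Set.mem_setOf_eq, Set.mem_pi, Set.mem_univ, true_implies]
  constructor
  · intro h i
    by_cases hi : i ∈ I
    · rw [if_pos hi, Set.mem_Icc]; exact abs_le.1 (h i hi)
    · rw [if_neg hi]; trivial
  · intro h i hi
    have := h i
    rw [if_pos hi, Set.mem_Icc] at this
    exact abs_le.2 this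

/-- The coordinate box is closed. [folklore] -/
theorem isClosed_coordBox (m : ℕ) (I : Finset (Fin m)) (c : ℝ) : IsClosed (coordBox m I c) := by
  have : coordBox m I c = ⋂ i ∈ I, {w : Fin m → ℝ | |w i| ≤ c} := by ext w; simp [coordBox]
  rw [this]
  exact isClosed_biInter fun i _ => isClosed_le (continuous_apply i).abs continuous_const

/-- **Measure of a coordinate box**: `𝒩(0,v)([-c,c])^{|I|}`. [folklore] -/
theorem pi_gaussianReal_coordBox (m : ℕ) (v : ℝ≥0) (I : Finset (Fin m)) (c : ℝ) :
    (Measure.pi fun _ : Fin m => gaussianReal 0 v) (coordBox m I c) = (gaussianReal 0 v (Set.Icc (-c) c)) ^ I.card := by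
  classical
  rw [coordBox_eq_pi, Measure.pi_pi]
  simp_rw [apply_ite (gaussianReal 0 v), measure_univ]
  rw [Finset.prod_ite_mem, Finset.univ_inter, Finset.prod_const]

/-! ### Orthonormal boxes: rotation invariance -/

/-- The box `{ω : |⟪b_i, ω⟫| ≤ c for i ∈ I}` of an orthonormal basis `b` of `ℝ^m`. [folklore] -/
def orthBox {m : ℕ} (b : OrthonormalBasis (Fin m) ℝ (EuclideanSpace ℝ (Fin m))) (I : Finset (Fin m)) (c : ℝ) :
    Set (Fin m → ℝ) := {w | ∀ i ∈ I, |⟪b i, toLp 2 w⟫_ℝ| ≤ c}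

/-- The coordinate box seen in `EuclideanSpace`. [folklore] -/
def coordBoxE (m : ℕ) (I : Finset (Fin m)) (c : ℝ) : Set (EuclideanSpace ℝ (Fin m)) := {u | ∀ i ∈ I, |u i| ≤ c}

/-- It is closed. [folklore] -/
theorem isClosed_coordBoxE (m : ℕ) (I : Finset (Fin m)) (c : ℝ) : IsClosed (coordBoxE m I c) := by
  have : coordBoxE m I c = ⋂ i ∈ I, {u : EuclideanSpace ℝ (Fin m) | |u i| ≤ c} := by ext u; simp [coordBoxE]
  rw [this]
  exact isClosed_biInter fun i _ => isClosed_le (PiLp.continuous_apply 2 _ i).abs continuous_const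

/-- **Rotation invariance**: the orthonormal box has the measure of the coordinate box (variance `1`).
[folklore] -/
theorem pi_gaussianReal_one_orthBox {m : ℕ} (b : OrthonormalBasis (Fin m) ℝ (EuclideanSpace ℝ (Fin m)))
    (I : Finset (Fin m)) (c : ℝ) :
    (Measure.pi fun _ : Fin m => gaussianReal 0 1) (orthBox b I c) =
      (Measure.pi fun _ : Fin m => gaussianReal 0 1) (coordBox m I c) := by
  set μ₁ : Measure (Fin m → ℝ) := Measure.pi fun _ : Fin m => gaussianReal 0 1 with hμ₁
  have hmeasE : MeasurableSet (coordBoxE m I c) := (isClosed_coordBoxE m I c).measurableSet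
  have htoLp : Measurable (toLp 2 : (Fin m → ℝ) → EuclideanSpace ℝ (Fin m)) := (PiLp.continuous_toLp 2 _).measurable
  have hrepr : Measurable (b.repr : EuclideanSpace ℝ (Fin m) → EuclideanSpace ℝ (Fin m)) := b.repr.continuous.measurable
  -- both boxes are preimages of the Euclidean coordinate box
  have e1 : orthBox b I c = (toLp 2) ⁻¹' ((b.repr) ⁻¹' coordBoxE m I c) := by
    ext w
    simp only [orthBox, coordBoxE, Set.mem_setOf_eq, Set.mem_preimage, OrthonormalBasis.repr_apply_apply]
  have e2 : coordBox m I c = (toLp 2) ⁻¹' coordBoxE m I c := by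
    ext w
    simp only [coordBox, coordBoxE, Set.mem_setOf_eq, Set.mem_preimage]
  have hstd : μ₁.map (toLp 2) = stdGaussian (EuclideanSpace ℝ (Fin m)) := map_pi_eq_stdGaussian
  rw [e1, e2, ← Measure.map_apply htoLp (hrepr hmeasE), ← Measure.map_apply htoLp hmeasE, hstd,
    ← Measure.map_apply hrepr hmeasE, stdGaussian_map b.repr]

/-! ### Slabs of linearly independent vectors -/

/-- The slab system `{ω : |v_j · ω| ≤ η ∀ j}`. [cite: DeRoeckHuveneers2015, §4.1 (`B_δ(k)`) and §5.5 (`Z`)] -/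
def slabs {m p : ℕ} (vs : Fin p → (Fin m → ℝ)) (η : ℝ) : Set (Fin m → ℝ) := {w | ∀ j, |vs j ⬝ᵥ w| ≤ η}

/-- The slab system is closed. [folklore] -/
theorem isClosed_slabs {m p : ℕ} (vs : Fin p → (Fin m → ℝ)) (η : ℝ) : IsClosed (slabs vs η) := by
  have : slabs vs η = ⋂ j, {w : Fin m → ℝ | |vs j ⬝ᵥ w| ≤ η} := by ext w; simp [slabs]
  rw [this]
  refine isClosed_iInter fun j => isClosed_le ?_ continuous_const
  exact (continuous_finsetSum _ fun i _ => continuous_const.mul (continuous_apply i)).abs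

/-- **Slab measure for variance `1`**: for linearly independent `v_1, …, v_p` there is `C ≥ 0` with
`⊗ᵐ𝒩(0,1)(slabs η) ≤ C η^p` for all `η ≥ 0`. [cite: DeRoeckHuveneers2015, §4.3 Lemma 3 ("the desired bound `∼ η^p` on the measure of an `η`-neighborhood of a subspace of codimension `p`")] -/
theorem pi_gaussianReal_one_slabs_le {m p : ℕ} {vs : Fin p → (Fin m → ℝ)} (hli : LinearIndependent ℝ vs) :
    ∃ C : ℝ, 0 ≤ C ∧ ∀ η : ℝ, 0 ≤ η →
      (Measure.pi fun _ : Fin m => gaussianReal 0 1) (slabs vs η) ≤ ENNReal.ofReal (C * η ^ p) := by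
  classical
  set E := EuclideanSpace ℝ (Fin m)
  have hpm : p ≤ m := by simpa using hli.fintype_card_le_finrank
  -- the family to orthonormalise: `v_i` for `i < p`, `0` beyond
  let f : Fin m → E := fun i => if h : i.val < p then toLp 2 (vs ⟨i.val, h⟩) else 0
  have hcard : Module.finrank ℝ E = Fintype.card (Fin m) := by simp [E]
  let b : OrthonormalBasis (Fin m) ℝ E := gramSchmidtOrthonormalBasis hcard f
  -- for `i < p`, `b i = gramSchmidtNormed f i ∈ span (toLp ∘ vs)`
  have hvsE : LinearIndependent ℝ (fun j => (toLp 2 (vs j) : E)) :=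
    hli.map' (WithLp.linearEquiv 2 ℝ (Fin m → ℝ)).symm.toLinearMap (LinearEquiv.ker _)
  have hne : ∀ i : Fin m, i.val < p → gramSchmidtNormed ℝ f i ≠ 0 := by
    intro i hi h0
    have h0' : gramSchmidt ℝ f i = 0 := by
      have h' : (‖gramSchmidt ℝ f i‖⁻¹ : ℝ) • gramSchmidt ℝ f i = 0 := h0
      rcases smul_eq_zero.1 h' with h1 | h1
      · exact norm_eq_zero.1 (inv_eq_zero.1 h1)
      · exact h1
    refine gramSchmidt_ne_zero_coe (𝕜 := ℝ) i ?_ h0'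
    -- `f` restricted to `Iic i` is an injective reindexing of a subfamily of `toLp ∘ vs`
    let g : Set.Iic i → Fin p := fun j => ⟨j.1.val, lt_of_le_of_lt (show j.1.val ≤ i.val from j.2) hi⟩
    have hg : Function.Injective g := fun j j' h => Subtype.ext (Fin.ext (by simpa [g] using congrArg Fin.val h))
    have hfg : f ∘ ((↑) : Set.Iic i → Fin m) = (fun j => (toLp 2 (vs j) : E)) ∘ g := by
      funext j
      have hj : j.1.val < p := lt_of_le_of_lt (show j.1.val ≤ i.val from j.2) hi
      simp [f, g, hj]
    rw [hfg]
    exact hvsE.comp g hg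
  have hbspan : ∀ i : Fin m, i.val < p → b i ∈ Submodule.span ℝ (Set.range fun j => (toLp 2 (vs j) : E)) := by
    intro i hi
    have hb : b i = gramSchmidtNormed ℝ f i := gramSchmidtOrthonormalBasis_apply hcard (hne i hi)
    rw [hb, gramSchmidtNormed]
    refine Submodule.smul_mem _ _ ?_
    have h1 := gramSchmidt_mem_span ℝ f (le_refl i)
    have h2 : Submodule.span ℝ (f '' Set.Iic i) ≤ Submodule.span ℝ (Set.range fun j => (toLp 2 (vs j) : E)) := by
      refine (Submodule.span_mono (Set.image_subset_range _ _)).trans ?_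
      rw [Submodule.span_le]
      rintro _ ⟨j, rfl⟩
      by_cases hj : j.val < p
      · simp only [f, hj, dif_pos]
        exact Submodule.subset_span ⟨⟨j.val, hj⟩, rfl⟩
      · simp only [f, hj, dif_neg, not_false_eq_true]
        exact Submodule.zero_mem _
    exact h2 h1
  -- coefficients `b i = ∑_j a i j • toLp (vs j)` for `i < p`
  have hcoef : ∀ i : Fin m, ∃ a : Fin p → ℝ, i.val < p → (∑ j, a j • (toLp 2 (vs j) : E)) = b i := by
    intro i
    by_cases hi : i.val < p
    · obtain ⟨a, ha⟩ := Submodule.mem_span_range_iff_exists_fun ℝ |>.1 (hbspan i hi)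
      exact ⟨a, fun _ => ha⟩
    · exact ⟨0, fun h => absurd h hi⟩
  choose a ha using hcoef
  set A : ℝ := ∑ i, ∑ j, |a i j| with hA
  have hA0 : 0 ≤ A := Finset.sum_nonneg fun i _ => Finset.sum_nonneg fun j _ => abs_nonneg _
  -- the slab system lies in the orthonormal box of half-width `A η`
  set I : Finset (Fin m) := Finset.univ.filter fun i : Fin m => i.val < p with hI
  have hIcard : I.card = p := by
    have : I = Finset.image (Fin.castLE hpm) Finset.univ := by
      ext i
      simp only [hI, Finset.mem_filter, Finset.mem_univ, true_and, Finset.mem_image]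
      constructor
      · intro h; exact ⟨⟨i.val, h⟩, Fin.ext rfl⟩
      · rintro ⟨j, rfl⟩; exact j.isLt
    rw [this, Finset.card_image_of_injective _ (Fin.castLE_injective hpm)]
    simp
  have hsub : ∀ η, 0 ≤ η → slabs vs η ⊆ orthBox b I (A * η) := by
    intro η hη w hw i hi
    have hi' : i.val < p := (Finset.mem_filter.1 hi).2
    rw [← ha i hi', sum_inner]
    calc |∑ j, ⟪a i j • (toLp 2 (vs j) : E), toLp 2 w⟫_ℝ|
        ≤ ∑ j, |⟪a i j • (toLp 2 (vs j) : E), toLp 2 w⟫_ℝ| := Finset.abs_sum_le_sum_abs _ _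
      _ = ∑ j, |a i j| * |vs j ⬝ᵥ w| := by
          refine Finset.sum_congr rfl fun j _ => ?_
          rw [real_inner_smul_left, EuclideanSpace.inner_toLp_toLp, abs_mul]
          simp [dotProduct_comm]
      _ ≤ ∑ j, |a i j| * η := Finset.sum_le_sum fun j _ => mul_le_mul_of_nonneg_left (hw j) (abs_nonneg _)
      _ = (∑ j, |a i j|) * η := by rw [Finset.sum_mul]
      _ ≤ A * η := by
          refine mul_le_mul_of_nonneg_right ?_ hη
          exact Finset.single_le_sum (f := fun i => ∑ j, |a i j|) (fun i _ => Finset.sum_nonneg fun j _ => abs_nonneg _)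
            (Finset.mem_univ i)
  refine ⟨(2 * A * (Real.sqrt (2 * Real.pi))⁻¹) ^ p, by positivity, fun η hη => ?_⟩
  calc (Measure.pi fun _ : Fin m => gaussianReal 0 1) (slabs vs η)
      ≤ (Measure.pi fun _ : Fin m => gaussianReal 0 1) (orthBox b I (A * η)) := measure_mono (hsub η hη)
    _ = (gaussianReal 0 1 (Set.Icc (-(A * η)) (A * η))) ^ p := by
        rw [pi_gaussianReal_one_orthBox, pi_gaussianReal_coordBox, hIcard]
    _ ≤ (ENNReal.ofReal (2 * (A * η) * (Real.sqrt (2 * Real.pi * (1 : ℝ≥0)))⁻¹)) ^ p :=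
        pow_le_pow_left' (gaussianReal_Icc_le one_ne_zero _) p
    _ = ENNReal.ofReal ((2 * A * (Real.sqrt (2 * Real.pi))⁻¹) ^ p * η ^ p) := by
        rw [← ENNReal.ofReal_pow (by positivity), ← mul_pow]
        congr 1
        simp only [NNReal.coe_one, mul_one]
        ring

/-- **Scaling**: `⊗ᵐ𝒩(0, v) = (⊗ᵐ𝒩(0,1)) ∘ (ω ↦ √v ω)⁻¹`. [folklore] -/
theorem pi_gaussianReal_eq_map_smul (m : ℕ) (v : ℝ≥0) :
    (Measure.pi fun _ : Fin m => gaussianReal 0 v) =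
      (Measure.pi fun _ : Fin m => gaussianReal 0 1).map (fun w => fun i => Real.sqrt v * w i) := by
  rw [Measure.pi_map_pi (fun _ => (measurable_const_mul _).aemeasurable)]
  congr 1
  funext i
  rw [gaussianReal_map_const_mul]
  congr 1
  · simp
  · ext; simp [Real.sq_sqrt v.coe_nonneg]

/-- **Slab measure for variance `v ≠ 0`**: `⊗ᵐ𝒩(0,v)(slabs η) ≤ C η^p`. [cite: DeRoeckHuveneers2015, §5.5 Lemma 4 (2) ("`⟨χ_Z⟩_T ≤ C δ^{n₂}`")] -/
theorem pi_gaussianReal_slabs_le {m p : ℕ} {vs : Fin p → (Fin m → ℝ)} (hli : LinearIndependent ℝ vs) {v : ℝ≥0} (hv : v ≠ 0) :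
    ∃ C : ℝ, 0 ≤ C ∧ ∀ η : ℝ, 0 ≤ η →
      (Measure.pi fun _ : Fin m => gaussianReal 0 v) (slabs vs η) ≤ ENNReal.ofReal (C * η ^ p) := by
  obtain ⟨C, hC, h⟩ := pi_gaussianReal_one_slabs_le hli
  have hv' : 0 < Real.sqrt v := Real.sqrt_pos.2 (lt_of_le_of_ne v.coe_nonneg (by exact_mod_cast hv.symm))
  refine ⟨C * ((Real.sqrt v)⁻¹) ^ p, by positivity, fun η hη => ?_⟩
  have hmeas : Measurable (fun w : Fin m → ℝ => fun i => Real.sqrt v * w i) := by fun_prop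
  rw [pi_gaussianReal_eq_map_smul m v, Measure.map_apply hmeas (isClosed_slabs vs η).measurableSet]
  have hpre : (fun w : Fin m → ℝ => fun i => Real.sqrt v * w i) ⁻¹' slabs vs η = slabs vs (η * (Real.sqrt v)⁻¹) := by
    ext w
    simp only [Set.mem_preimage, slabs, Set.mem_setOf_eq]
    have e : ∀ j, vs j ⬝ᵥ (fun i => Real.sqrt v * w i) = Real.sqrt v * (vs j ⬝ᵥ w) := by
      intro j; simp only [dotProduct, Finset.mul_sum]; exact Finset.sum_congr rfl fun i _ => by ring
    simp only [e, abs_mul, abs_of_pos hv']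
    constructor
    · intro h' j; rw [le_mul_inv_iff₀ hv']; linarith [h' j]
    · intro h' j; have := h' j; rw [le_mul_inv_iff₀ hv'] at this; linarith
  rw [hpre]
  refine (h _ (by positivity)).trans (le_of_eq ?_)
  congr 1
  rw [mul_pow]; ring

/-! ### Absorption of polynomial weights -/

/-- `t^M e^{-t/(4v)} ≤ M! (4v)^M` for `t ≥ 0`. [folklore] -/
theorem pow_mul_exp_neg_le {v : ℝ} (hv : 0 < v) (M : ℕ) {t : ℝ} (ht : 0 ≤ t) :
    t ^ M * Real.exp (-(t / (4 * v))) ≤ M.factorial * (4 * v) ^ M := by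
  have hs : 0 ≤ t / (4 * v) := by positivity
  have h1 : (t / (4 * v)) ^ M / M.factorial ≤ Real.exp (t / (4 * v)) := Real.pow_div_factorial_le_exp _ hs M
  have hfac : (0 : ℝ) < M.factorial := by exact_mod_cast Nat.factorial_pos M
  rw [div_pow, div_div, div_le_iff₀ (by positivity)] at h1
  calc t ^ M * Real.exp (-(t / (4 * v)))
      ≤ Real.exp (t / (4 * v)) * ((4 * v) ^ M * M.factorial) * Real.exp (-(t / (4 * v))) := by
        gcongr
    _ = M.factorial * (4 * v) ^ M := by
        rw [show Real.exp (t / (4 * v)) * ((4 * v) ^ M * M.factorial) * Real.exp (-(t / (4 * v))) =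
          ((4 * v) ^ M * M.factorial) * (Real.exp (t / (4 * v)) * Real.exp (-(t / (4 * v)))) by ring,
          ← Real.exp_add, add_neg_cancel, Real.exp_zero, mul_one, mul_comm]

/-- **Pointwise absorption**: `(1 + s)^M e^{-s²/(4v)} ≤ 2^M (2 + M!(4v)^M)` for `s ≥ 0`. [folklore] -/
theorem weight_absorb_le {v : ℝ} (hv : 0 < v) (M : ℕ) {s : ℝ} (hs : 0 ≤ s) :
    (1 + s) ^ M * Real.exp (-(s ^ 2 / (4 * v))) ≤ 2 ^ M * (2 + M.factorial * (4 * v) ^ M) := by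
  have hE : Real.exp (-(s ^ 2 / (4 * v))) ≤ 1 := by
    rw [Real.exp_le_one_iff]; exact neg_nonpos.2 (by positivity)
  have hE0 : 0 ≤ Real.exp (-(s ^ 2 / (4 * v))) := (Real.exp_pos _).le
  -- `(1+s)^M ≤ 2^M max(1,s)^M ≤ 2^M (1 + s^{2M} + 1)`
  have h1 : (1 + s) ^ M ≤ 2 ^ M * (2 + s ^ (2 * M)) := by
    have hmax : 1 + s ≤ 2 * max 1 s := by
      rcases le_total 1 s with h | h
      · rw [max_eq_right h]; linarith
      · rw [max_eq_left h]; linarith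
    have h2 : (1 + s) ^ M ≤ (2 * max 1 s) ^ M := pow_le_pow_left₀ (by positivity) hmax M
    have h3 : (max 1 s) ^ M ≤ 2 + s ^ (2 * M) := by
      rcases le_total 1 s with h | h
      · rw [max_eq_right h, pow_mul]
        have : s ^ M ≤ (s ^ M) ^ 2 := by
          have h1M : 1 ≤ s ^ M := one_le_pow₀ h
          nlinarith
        have h' : (s ^ M) ^ 2 = (s ^ 2) ^ M := by ring
        linarith [pow_nonneg hs (2 * M), h'.symm.le, h'.le, pow_mul s 2 M]
      · rw [max_eq_left h, one_pow]; linarith [pow_nonneg hs (2 * M)]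
    calc (1 + s) ^ M ≤ (2 * max 1 s) ^ M := h2
      _ = 2 ^ M * (max 1 s) ^ M := by rw [mul_pow]
      _ ≤ 2 ^ M * (2 + s ^ (2 * M)) := by gcongr
  have h4 : s ^ (2 * M) * Real.exp (-(s ^ 2 / (4 * v))) ≤ M.factorial * (4 * v) ^ M := by
    rw [pow_mul]; exact pow_mul_exp_neg_le hv M (sq_nonneg s)
  calc (1 + s) ^ M * Real.exp (-(s ^ 2 / (4 * v)))
      ≤ 2 ^ M * (2 + s ^ (2 * M)) * Real.exp (-(s ^ 2 / (4 * v))) := by gcongr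
    _ = 2 ^ M * (2 * Real.exp (-(s ^ 2 / (4 * v))) + s ^ (2 * M) * Real.exp (-(s ^ 2 / (4 * v)))) := by ring
    _ ≤ 2 ^ M * (2 * 1 + M.factorial * (4 * v) ^ M) := by gcongr
    _ = 2 ^ M * (2 + M.factorial * (4 * v) ^ M) := by ring

/-- The sup norm is dominated by the Euclidean sum of squares: `‖ω‖² ≤ ∑ ω_i²`. [folklore] -/
theorem norm_sq_le_sum_sq {m : ℕ} (w : Fin m → ℝ) : ‖w‖ ^ 2 ≤ ∑ i, w i ^ 2 := by
  rcases Nat.eq_zero_or_pos m with hm | hm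
  · subst hm
    simp [Subsingleton.elim w 0]
  · haveI : Nonempty (Fin m) := ⟨⟨0, hm⟩⟩
    obtain ⟨i, -, hi⟩ := Finset.exists_max_image Finset.univ (fun i => |w i|) Finset.univ_nonempty
    have hnorm : ‖w‖ = |w i| := by
      apply le_antisymm
      · exact (pi_norm_le_iff_of_nonneg (abs_nonneg _)).2 fun j => by rw [Real.norm_eq_abs]; exact hi j (Finset.mem_univ j)
      · have := norm_le_pi_norm w i; rwa [Real.norm_eq_abs] at this
    rw [hnorm, sq_abs]
    exact Finset.single_le_sum (f := fun i => w i ^ 2) (fun j _ => sq_nonneg _) (Finset.mem_univ i)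

/-- **Absorption of polynomial weights into the Gaussian**: for measurable `S`,
`∫ 𝟙_S (1 + ‖ω‖)^M d⊗ᵐ𝒩(0,v) ≤ K · ⊗ᵐ𝒩(0,2v)(S)` with `K = K(m, M, v)`.
[cite: DeRoeckHuveneers2015, §5.6 ("`p(ω)² e^{-|ω|²/(2T)} ≤ C e^{-|ω|²/(4T)}`")] -/
theorem lintegral_indicator_weight_le (m M : ℕ) {v : ℝ≥0} (hv : v ≠ 0) :
    ∃ K : ℝ, 0 ≤ K ∧ ∀ S : Set (Fin m → ℝ), MeasurableSet S →
      ∫⁻ w, S.indicator (fun w => ENNReal.ofReal ((1 + ‖w‖) ^ M)) w ∂(Measure.pi fun _ : Fin m => gaussianReal 0 v) ≤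
        ENNReal.ofReal K * (Measure.pi fun _ : Fin m => gaussianReal 0 (2 * v)) S := by
  have hv0 : (0 : ℝ) < v := lt_of_le_of_ne v.coe_nonneg (by exact_mod_cast hv.symm)
  have h2v : (2 * v : ℝ≥0) ≠ 0 := mul_ne_zero two_ne_zero hv
  set c₁ : ℝ := (Real.sqrt (2 * Real.pi * v))⁻¹ ^ m with hc₁
  set c₂ : ℝ := (Real.sqrt (2 * Real.pi * (2 * v : ℝ≥0)))⁻¹ ^ m with hc₂
  have hc₁0 : 0 < c₁ := by positivity
  have hc₂0 : 0 < c₂ := by positivity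
  set K₀ : ℝ := 2 ^ M * (2 + M.factorial * (4 * (v : ℝ)) ^ M) with hK₀
  have hK₀0 : 0 ≤ K₀ := by positivity
  refine ⟨c₁ * K₀ * c₂⁻¹, by positivity, fun S hS => ?_⟩
  set d₁ : (Fin m → ℝ) → ℝ≥0∞ := fun w => ENNReal.ofReal (Real.exp (-(∑ i, w i ^ 2 / 2) / v)) with hd₁
  set d₂ : (Fin m → ℝ) → ℝ≥0∞ := fun w => ENNReal.ofReal (Real.exp (-(∑ i, w i ^ 2 / 2) / (2 * v : ℝ≥0))) with hd₂
  have hd₁m : Measurable d₁ := by fun_prop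
  have hd₂m : Measurable d₂ := by fun_prop
  have e₁ := pi_gaussianReal_eq_smul_withDensity m hv
  have e₂ := pi_gaussianReal_eq_smul_withDensity m h2v
  -- pointwise: `𝟙_S (1+‖w‖)^M d₁ ≤ K₀ 𝟙_S d₂`
  have hpt : ∀ w, S.indicator (fun w => ENNReal.ofReal ((1 + ‖w‖) ^ M)) w * d₁ w ≤
      ENNReal.ofReal K₀ * S.indicator d₂ w := by
    intro w
    by_cases hw : w ∈ S
    · rw [Set.indicator_of_mem hw, Set.indicator_of_mem hw, hd₁, hd₂]
      simp only []
      rw [← ENNReal.ofReal_mul (by positivity), ← ENNReal.ofReal_mul hK₀0]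
      refine ENNReal.ofReal_le_ofReal ?_
      set Q : ℝ := ∑ i, w i ^ 2 with hQ
      have hQ0 : 0 ≤ Q := Finset.sum_nonneg fun i _ => sq_nonneg _
      have eQ : ∑ i, w i ^ 2 / 2 = Q / 2 := by rw [hQ, Finset.sum_div]
      rw [eQ]
      have e1 : Real.exp (-(Q / 2) / v) = Real.exp (-(Q / (4 * v))) * Real.exp (-(Q / 2) / (2 * v : ℝ≥0)) := by
        rw [← Real.exp_add]; congr 1; push_cast; field_simp; ring
      rw [e1, ← mul_assoc]
      refine mul_le_mul_of_nonneg_right ?_ (Real.exp_pos _).le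
      -- `(1+‖w‖)^M e^{-Q/4v} ≤ (1+√Q)^M e^{-Q/4v} ≤ K₀`
      have hnorm : ‖w‖ ≤ Real.sqrt Q := by
        rw [← Real.sqrt_sq (norm_nonneg w)]
        exact Real.sqrt_le_sqrt (norm_sq_le_sum_sq w)
      calc (1 + ‖w‖) ^ M * Real.exp (-(Q / (4 * v)))
          ≤ (1 + Real.sqrt Q) ^ M * Real.exp (-((Real.sqrt Q) ^ 2 / (4 * v))) := by
            rw [Real.sq_sqrt hQ0]; gcongr
        _ ≤ K₀ := weight_absorb_le hv0 M (Real.sqrt_nonneg Q)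
    · simp [Set.indicator_of_notMem hw]
  -- integrate
  have hind : Measurable (S.indicator fun w : Fin m → ℝ => ENNReal.ofReal ((1 + ‖w‖) ^ M)) :=
    (ENNReal.measurable_ofReal.comp ((continuous_const.add continuous_norm).pow M).measurable).indicator hS
  calc ∫⁻ w, S.indicator (fun w => ENNReal.ofReal ((1 + ‖w‖) ^ M)) w ∂(Measure.pi fun _ : Fin m => gaussianReal 0 v)
      = ENNReal.ofReal c₁ * ∫⁻ w, S.indicator (fun w => ENNReal.ofReal ((1 + ‖w‖) ^ M)) w * d₁ w ∂volume := by
        rw [e₁, lintegral_smul_measure, lintegral_withDensity_eq_lintegral_mul _ hd₁m hind]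
        simp only [Pi.mul_apply, smul_eq_mul]
        congr 1
        exact lintegral_congr fun w => mul_comm _ _
    _ ≤ ENNReal.ofReal c₁ * ∫⁻ w, ENNReal.ofReal K₀ * S.indicator d₂ w ∂volume :=
        mul_le_mul_right (lintegral_mono fun w => hpt w) _
    _ = ENNReal.ofReal (c₁ * K₀) * ∫⁻ w, S.indicator d₂ w ∂volume := by
        rw [lintegral_const_mul _ (hd₂m.indicator hS), ← mul_assoc, ← ENNReal.ofReal_mul hc₁0.le]
    _ = ENNReal.ofReal (c₁ * K₀ * c₂⁻¹ * c₂) * ∫⁻ w, S.indicator d₂ w ∂volume := by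
        rw [show c₁ * K₀ * c₂⁻¹ * c₂ = c₁ * K₀ by field_simp]
    _ = ENNReal.ofReal (c₁ * K₀ * c₂⁻¹) * (ENNReal.ofReal c₂ * ∫⁻ w, S.indicator d₂ w ∂volume) := by
        rw [ENNReal.ofReal_mul (by positivity), mul_assoc]
    _ = ENNReal.ofReal (c₁ * K₀ * c₂⁻¹) * (Measure.pi fun _ : Fin m => gaussianReal 0 (2 * v)) S := by
        congr 1
        rw [e₂, Measure.smul_apply, withDensity_apply _ hS, lintegral_indicator hS, smul_eq_mul]

end Literature.Probability.Distributions

end
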